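import Mathlib
import HarnessLib
import Summits.Langlands.Statement
import Summits.Langlands.Langlands.Theses.WachComponentCensus
import Literature.NumberTheory.GaloisRepresentations.LocalKroneckerWeberInertiaProofs
import Literature.NumberTheory.PAdicHodge.FontaineDpst

/-!
# `LiftB2UnramSplitP` (item stmt-Langlands-12044): the pin hypothesis in LOCAL form

`Theorems/WachComponentCensusLiftB2UnramSplitPInPrint` proves the route decl
`Summit.Langlands.Langlands.Theses.WachComponentCensus.LiftB2UnramSplitP` from four named facts and
the hypothesis `hpin` — the first conjunct of the decl, the Hodge–Tate pin `HT_τ(χ) = {-m}` for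
every GLOBAL rank-one `χ : Γ_F →ₜ* GL₁(ℚ̄_p)` with entries `ε_F^m`, at every `v ∣ p`, for
Fontaine's PINNED datum `fontainePstAdicCompletion v p hv` (D-0018 L2).  That pin is not
derivable from the present specification `IsFontaineDatum` (F1)–(F7) of the datum; the designed
repair is ONE additional LOCAL clause (F8) on a `p`-adic Hodge datum `𝔇` of a `p`-adic field `K`:

  (F8)  for every `m : ℤ` and every rank-one framed `χ : Γ_K →ₜ* GL₁(ℚ̄_p)` with entries
        `ε_K(σ)^m`, and every `ℚ_p`-embedding `τ : K → ℚ̄_p` (for `𝔇.algebra`),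
        `𝔇.𝔅.labelledHodgeTateWeights χ τ = {-m}`

(a theorem for the genuine `B_dR(K)`: `D_dR(ℚ_p(m)) = K · t^{-m}`, Fontaine 1994, Exp. III §1.5;
Barnet-Lamb–Gee–Geraghty–Taylor, Notation: `HT_τ(ε) = {-1}`).

This file (helper, `--supports stmt-Langlands-12044`) records that the LOCAL clause, asserted of
the pinned datum of every completion `F_v`, `v ∣ p`, is all the pin needs:

* `pin_of_localClause` — the global pin (exactly the hypothesis `hpin` of
  `liftB2UnramSplitP_of_facts`, no reciprocity datum in sight) from the local clause, by the
  compatibility of the cyclotomic character with restriction to a decomposition group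
  (accepted `cyclotomicCharacter_absGaloisRestrict`); this is the `RD`-free form of
  `Theorems.LiftB2CrysSplitP.pin_of_localPin` of the sibling route `TriangulineChamber`, whose
  four `∃ RD`-slices carry the same conjunct;
* `liftB2UnramSplitP_of_localClause_of_rest` — the route decl from the local clause and its
  pin-free REMAINDER (the route text minus the first conjunct, verbatim): the restated signature,
  should the planner drop the pin conjunct, which has been idle as a guard on `RD` since the datum
  was pinned (D-0018 L2).
(The companion file `WachComponentCensusLiftB2UnramSplitPLocalPinFacts` feeds the local clause
into `liftB2UnramSplitP_of_facts`, i.e. proves the decl from the clause and the four named facts.)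

So the pin debt of ALL `∃ RD`-slices of `WachComponentCensus` (`LiftB2Unram`, `LiftB2UnramSmallF`,
`LiftB2UnramLargeF`, `LiftB2UnramSplitP`) and of `TriangulineChamber` is one and the same local
clause; once (F8) is a field of `IsFontaineDatum`, `hloc` below is
`(isFontaineDatum_fontainePstAdicCompletion h v p hv).⟨F8⟩` under `FontaineDatumExists`.
No statement of the route file is altered; no definition is introduced.  Conditional result;
axioms `propext`, `Classical.choice`, `Quot.sound`.
-/

noncomputable section

-- project-wide option (lakefile weak.linter.dupNamespace); `Summit.Langlands.Langlands` is mandated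
set_option linter.dupNamespace false

open scoped MatrixGroups Matrix NumberField
open NumberField IsDedekindDomain Field

namespace Summit.Langlands.Langlands.Theorems

open Literature.NumberTheory.Automorphic Literature.NumberTheory.GaloisRepresentations
open Literature.NumberTheory.PAdicHodge

/-- **The cyclotomic-powers pin from its local clause (no reciprocity datum).**  Let `F` be a
number field and `p` a prime, and suppose that at every `v ∣ p` the pinned datum
`D = fontainePstAdicCompletion v p hv` satisfies the local clause (F8): every rank-one framed
`χᵥ : Γ_{F_v} →ₜ* GL₁(ℚ̄_p)` with entries `ε_{F_v}(σ)^m` has `τ`-labelled Hodge–Tate weights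
`{-m}` for every `ℚ_p`-embedding `τ : F_v → ℚ̄_p` (w.r.t. `D.algebra`).  Then every global
rank-one `χ : Γ_F →ₜ* GL₁(ℚ̄_p)` with entries `ε_F(σ)^m` has
`χ.labelledHodgeTateWeightsAt v D.algebra D.𝔅 τ = {-m}` at every `v ∣ p` — the hypothesis `hpin`
of `liftB2UnramSplitP_of_facts` at `(F, p)` — since `χ|_{Γ_{F_v}}` has entries `ε_{F_v}^m`
(`cyclotomicCharacter_absGaloisRestrict`) and `labelledHodgeTateWeightsAt` is, by definition,
the labelled weight multiset of `χ|_{Γ_{F_v}}`. [folklore] -/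
theorem pin_of_localClause (F : Type) [Field F] [NumberField F] (p : ℕ) [Fact p.Prime]
    (hloc : ∀ (v : HeightOneSpectrum (𝓞 F)) (hv : ((p : ℕ) : 𝓞 F) ∈ v.asIdeal) (m : ℤ)
      (χv : FramedGaloisRep (v.adicCompletion F) (PadicAlgCl p) 1),
      (∀ σ, (χv σ).val 0 0 = algebraMap ℚ_[p] (PadicAlgCl p)
        ((((GaloisRep.cyclotomicCharacter (v.adicCompletion F) p σ : ℤ_[p]ˣ) : ℤ_[p]) :
          ℚ_[p]) ^ m)) →
      let D := fontainePstAdicCompletion v p hv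
      letI := D.algebra
      ∀ τ : v.adicCompletion F →ₐ[ℚ_[p]] PadicAlgCl p,
        D.𝔅.labelledHodgeTateWeights χv.toGaloisRep τ.toRingHom = {-m})
    (m : ℤ) (χ : FramedGaloisRep F (PadicAlgCl p) 1)
    (hχ : ∀ σ, (χ σ).val 0 0 = algebraMap ℚ_[p] (PadicAlgCl p)
      ((((GaloisRep.cyclotomicCharacter F p σ : ℤ_[p]ˣ) : ℤ_[p]) : ℚ_[p]) ^ m))
    (v : HeightOneSpectrum (𝓞 F)) (hv : ((p : ℕ) : 𝓞 F) ∈ v.asIdeal) :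
    letI := (fontainePstAdicCompletion v p hv).algebra
    ∀ τ : v.adicCompletion F →ₐ[ℚ_[p]] PadicAlgCl p,
      χ.labelledHodgeTateWeightsAt v (fontainePstAdicCompletion v p hv).algebra
        (fontainePstAdicCompletion v p hv).𝔅 τ.toRingHom = {-m} := by
  -- the entries of `χ|_{Γ_{F_v}}` are `ε_{F_v}^m`
  have hχv : ∀ σ, ((χ.toLocal v) σ).val 0 0 = algebraMap ℚ_[p] (PadicAlgCl p)
      ((((GaloisRep.cyclotomicCharacter (v.adicCompletion F) p σ : ℤ_[p]ˣ) : ℤ_[p]) :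
        ℚ_[p]) ^ m) := by
    intro σ
    rw [FramedGaloisRep.toLocal_apply, hχ,
      cyclotomicCharacter_absGaloisRestrict F (v.adicCompletion F) p σ]
  exact hloc v hv m (χ.toLocal v) hχv

/-- **`LiftB2UnramSplitP` = local pin clause + the pin-free remainder** (planner-facing record of
the restated signature).  Since D-0018 L2 the datum `RD.pst p v hv` is pinned by definition and no
longer constrains the choice of `RD`, so the first conjunct of the route decl is idle as a guard
and is exactly the local clause (F8) of the pinned datum (`pin_of_localClause`).  If that clause
holds for every completion above `p` of every number field (`hloc`) and the REMAINDER holds —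
the route text of `LiftB2UnramSplitP` with the first conjunct deleted (`hrest`, verbatim) — then
`LiftB2UnramSplitP`. [folklore] -/
theorem liftB2UnramSplitP_of_localClause_of_rest
    (hloc : ∀ (F : Type) [Field F] [NumberField F] (p : ℕ) [Fact p.Prime]
      (v : HeightOneSpectrum (𝓞 F)) (hv : ((p : ℕ) : 𝓞 F) ∈ v.asIdeal) (m : ℤ)
      (χv : FramedGaloisRep (v.adicCompletion F) (PadicAlgCl p) 1),
      (∀ σ, (χv σ).val 0 0 = algebraMap ℚ_[p] (PadicAlgCl p)
        ((((GaloisRep.cyclotomicCharacter (v.adicCompletion F) p σ : ℤ_[p]ˣ) : ℤ_[p]) :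
          ℚ_[p]) ^ m)) →
      let D := fontainePstAdicCompletion v p hv
      letI := D.algebra
      ∀ τ : v.adicCompletion F →ₐ[ℚ_[p]] PadicAlgCl p,
        D.𝔅.labelledHodgeTateWeights χv.toGaloisRep τ.toRingHom = {-m})
    (hrest : ∀ (F : Type) [Field F] [NumberField F] [NumberField.IsTotallyReal F] (p : ℕ)
      [Fact p.Prime], 7 ≤ p → ¬ ((p : ℤ) ∣ NumberField.discr F) →
      (∀ v : IsDedekindDomain.HeightOneSpectrum (NumberField.RingOfIntegers F),
        ((p : ℕ) : NumberField.RingOfIntegers F) ∈ v.asIdeal → v.residueCard = p) →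
      ∃ RD : ReciprocityData F,
      ∀ hcpt : Literature.NumberTheory.Automorphic.isCompact_glFiniteIntegralLevel 2 F, (∀ π :
      Literature.NumberTheory.Automorphic.CuspidalAutomorphicRepData 2 F hcpt, π.1.IsLAlgebraic →
      (∃ T : Literature.NumberTheory.Automorphic.InfinityType F 2, π.1.HasInfinityType T ∧
      T.IsRegular) → ∀ (ℓ : ℕ) [Fact ℓ.Prime] (ι : PadicAlgCl ℓ ≃+* ℂ), ∃ ρ :
      Literature.NumberTheory.GaloisRepresentations.FramedGaloisRep F (PadicAlgCl ℓ) 2,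
      ρ.toGaloisRep.IsIrreducible ∧ IsGeometricFramed RD ρ ∧ Corresponds RD ι π.1 ρ) ∧ (∀ (ι :
      PadicAlgCl p ≃+* ℂ) (ρ : Literature.NumberTheory.GaloisRepresentations.FramedGaloisRep F
      (PadicAlgCl p) 2), ρ.toGaloisRep.IsIrreducible → IsGeometricFramed RD ρ → ρ.IsOdd → (∀ (v :
      IsDedekindDomain.HeightOneSpectrum (NumberField.RingOfIntegers F)) (hv : ((p : ℕ) :
      NumberField.RingOfIntegers F) ∈ v.asIdeal), let D := RD.pst p v hv;
      D.IsCrystallineFramed (ρ.toLocal v) ∧ (letI := D.algebra;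
      ∀ τ : v.adicCompletion F →ₐ[ℚ_[p]] PadicAlgCl p,
      let M := ρ.labelledHodgeTateWeightsAt v D.algebra D.𝔅 τ.toRingHom;
      M.Nodup ∧ Multiset.card M = 2)) →
      (¬ ∃ χ₁ χ₂ : Field.absoluteGaloisGroup (CyclotomicField p F) →* (PadicAlgCl p)ˣ,
      IsOpen (χ₁.ker : Set (Field.absoluteGaloisGroup (CyclotomicField p F))) ∧ IsOpen (χ₂.ker :
      Set (Field.absoluteGaloisGroup (CyclotomicField p F))) ∧ ∀ σ, ‖(ρ.restrictField
      (CyclotomicField p F) σ).val.trace - ((χ₁ σ : PadicAlgCl p) + (χ₂ σ : PadicAlgCl p))‖ < 1)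
      → (∃ (π₀ : Literature.NumberTheory.Automorphic.CuspidalAutomorphicRepData 2 F hcpt) (ρ₀ :
      Literature.NumberTheory.GaloisRepresentations.FramedGaloisRep F (PadicAlgCl p) 2),
      π₀.1.IsLAlgebraic ∧ (∃ T : Literature.NumberTheory.Automorphic.InfinityType F 2,
      π₀.1.HasInfinityType T ∧ T.IsRegular) ∧ Corresponds RD ι π₀.1 ρ₀ ∧ ∀ σ, ‖(ρ σ).val.trace -
      (ρ₀ σ).val.trace‖ < 1) → ∃ π :
      Literature.NumberTheory.Automorphic.CuspidalAutomorphicRepData 2 F hcpt, π.1.IsLAlgebraic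
      ∧ Corresponds RD ι π.1 ρ)) :
    Summit.Langlands.Langlands.Theses.WachComponentCensus.LiftB2UnramSplitP := by
  intro F _ _ _ p _ hp hdisc hsplit
  obtain ⟨RD, hRD⟩ := hrest F p hp hdisc hsplit
  exact ⟨RD, fun m χ hχ v hv => pin_of_localClause F p (hloc F p) m χ hχ v hv, hRD⟩

end Summit.Langlands.Langlands.Theorems

end
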